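import Summits.Ventures.Crystal3D.Theorems.StickyWulffConstantTextureBuildCellCover
import HarnessLib

/-!
# TB-1: the CERTIFIED CELL COVER, PART 2 — the LABELLED POLYHEDRAL MESH that the texture assembly (TB-D) consumes, and the level-2 composition over it
# (lane T, crux `TextureLiminfV5`, stmt-Ventures-23912; `stub_textureBuild` → TB-0.md §7/§7.1; cf-p1 DECISION (cxiii))

HONEST FRAMING. Venture `Summits/Ventures/Crystal3D` (cell `crystal3d-full`), route `route-Ventures-StickyWulffConstant`, helper `--supports` the
law-v5 crux `TextureLiminfV5` (stmt-Ventures-23912).  DEFINITIONS (the part-2 interface, v1) + one composition by pure logic (census-free, standard axioms).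
No mesh is constructed, no texture is built; rung F-C1 not moved.  v1 = the clauses TB-0.md §7/§7.1 identify as what TB-D needs; the TB-D proof may refine them
(the level-2 composition of …TextureBuildCellCover is parametric, so a v2 costs nothing upstream).

THE MESH (`Mesh cv δ` over a `CellCover`), all in ACTUAL position:
* TERRITORIES `D f = ⋃_j polytope (HD f j)` (bounded open H-polytopes, unit normals), one per tent piece, pairwise disjoint, disjoint from the closed placed
  cylinders `Z k`; the tent's free zone is `U f = D f ∖ (closed √2-collar of the cells)` (`hU`), so that owned tent balls never meet a cell's balls;
* SOLIDITY: on the collar `D f ∖ U f` every `S_f`-site within `√2` is in the tent set `Xh f` (`hcollar`; there the tent solid is a.e. SOLID by the containment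
  clause of `BarlowFreeCertificate`, so the uncertified part of the tent has no boundary); on `∂(D f)` every point is SOLID, or EMPTY (`√2`-far from `Xh f`: the
  tent solid lies within `√2` of `Xh f`), or on a DESIGNATED territory facet, with — in the solid case — `f`-MATERIAL across (`hbdry`); the deep parts of
  every cell are WRAPPED in solid territory of the right grain (`hwrap₁/hwrap₂`); the cells' law tables are FULL (`hlaw`: the texture pays what the cell certifies);
* CELLS ↔ GRAINS: bottom/top grain indices `fk k ≠ gk k` with STACKING CONSISTENCY (the placed plate stackings ARE the tents' stackings, `hS₁/hS₂`); the territory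
  of the bottom (top) grain meets `Z k` only at model heights `≤ −R₀` (`≥ h_k + R₀`), no third territory meets it (`hside₁/hside₂/hside₀`);
* AGREEMENT: where two territories touch, both are solid there and the two stackings COINCIDE as site sets near the contact (`hagree`; TB-0.md §6: agreement
  cuts are free — equal bilayer lattices);
* GAP PIECES: finitely many bounded open polytopes `Q l` with grain labels, pairwise disjoint, disjoint from territories and cells; every NON-designated facet point
  of a gap piece has a neighbourhood inside `closure (Q l) ∪ (label-l material)` (`hQmatch`); DESIGNATED facets (gap pieces and territories) have total
  `facetArea ≤ gapArea` (`hgapArea`); `gapCost := 3·(gapArea + Σ_k 2πρ_k(h_k + 4R₀ + 2))` (3 ≥ every support value of `wulffOf`/`wallBody` on unit vectors;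
  the cylinders' lateral surfaces are booked whole);
* MASS: at least `(1 − δ)N` balls are INTERIOR (all `S_f`-sites within `2√2` in `Xh f`, the `√2`-ball inside `D f` or deep inside a cell half of `f`).
THE COMPOSITION `shadowTheoremSatAtomicV5_of_mesh`: «TB-cover(mesh)» (every saturated near-optimal cluster admits a cover AND a mesh with
`tilingLoss + rimSum + gapCost ≤ θ·N^{2/3}`) + «TB-energy(mesh)» (cover + mesh ⇒ law-v5 texture with mass `≥ (1−δ)N` and
`energy ≤ tentBudget + chargeSum + gapCost`) + the wall law ⇒ `ShadowTheoremSatAtomicV5` (via `CellCover.tentBudget_add_chargeSum_le`).  These two inputs are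
the registrable level-2 stubs `stub_TB_cover` / `stub_TB_energy` of TexShadow v8.5.
WHAT THIS IS NOT: crust cells (third piece kind, TB-0.md §7 end) are not yet here — v1 covers are crust-free (`Q* = ∅`); no mesh is exhibited; F-C1 not moved.
-/

noncomputable section

open scoped BigOperators InnerProductSpace ENNReal
open MeasureTheory

namespace Summit.Ventures.Crystal3D.Cruxes.TextureLiminf.TexShadow

open Summit.Ventures.Crystal3D Summit.Ventures.Crystal3D.Theorems Finset
open Literature.MathematicalPhysics.StatisticalMechanics (IsHaggSeq fccStacking barlowStacking contactDeficiency)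

namespace CellCover

variable {C R₀ : ℝ} {N : ℕ} {x : Fin N → E3}

/-- the placed (closed) cylinder of cell `k` -/
def Z (cv : CellCover C R₀ N x) (k : Fin cv.nk) : Set E3 :=
  rigid (cv.cell k).M (cv.cell k).t '' cyl R₀ (cv.cell k).h (cv.cell k).ρ

/-- model height of an actual point with respect to cell `k` -/
def height (cv : CellCover C R₀ N x) (k : Fin cv.nk) (y : E3) : ℝ := ((cv.cell k).M.symm (y - (cv.cell k).t)) 2

/-- the DEEP BOTTOM half of cell `k` (model heights `≤ −1`: below every admissible cut) -/
def Zlow (cv : CellCover C R₀ N x) (k : Fin cv.nk) : Set E3 := cv.Z k ∩ {y | cv.height k y ≤ -1}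

/-- the DEEP TOP half of cell `k` (model heights `≥ h_k + 1`) -/
def Zhigh (cv : CellCover C R₀ N x) (k : Fin cv.nk) : Set E3 := cv.Z k ∩ {y | (cv.cell k).h + 1 ≤ cv.height k y}

/-- the stacking of tent piece `f` -/
def S (cv : CellCover C R₀ N x) (f : Fin cv.ng) : Set E3 := stacking (cv.tent f).L (cv.tent f).s (cv.tent f).σ

/-- `y` is an `f`-SOLID point: every `S_f`-site within `√2` of `y` is in the tent set (then the tent solid a.e. contains a neighbourhood's worth of `y`). -/
def SolidAt (cv : CellCover C R₀ N x) (f : Fin cv.ng) (y : E3) : Prop :=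
  ∀ b ∈ cv.S f, dist y b ≤ Real.sqrt 2 → b ∈ (cv.tent f).Xh

/-- `y` is an `f`-EMPTY point: `√2`-far from the tent set (the tent solid lies within `√2` of it). -/
def EmptyAt (cv : CellCover C R₀ N x) (f : Fin cv.ng) (y : E3) : Prop :=
  ∀ b ∈ (cv.tent f).Xh, Real.sqrt 2 < dist y b

/-- an INTERIOR ball of grain `f` for the mass count: all `S_f`-sites within `2√2` are in the tent set. -/
def DeepAt (cv : CellCover C R₀ N x) (f : Fin cv.ng) (a : E3) : Prop :=
  ∀ b ∈ cv.S f, dist a b ≤ 2 * Real.sqrt 2 → b ∈ (cv.tent f).Xh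

end CellCover

/-- the facet of the H-polytope `H` carried by the half-space datum `p` -/
def facetOf (H : Finset (E3 × ℝ)) (p : E3 × ℝ) : Set E3 := closure (polytope H) ∩ {y | ⟪p.1, y⟫_ℝ = p.2}

open scoped Classical in
/-- **THE LABELLED POLYHEDRAL MESH of a cover (part 2 of the interface, v1).** -/
structure Mesh {C R₀ : ℝ} {N : ℕ} {x : Fin N → E3} (cv : CellCover C R₀ N x) (δ : ℝ) where
  /-- territories: finite unions of bounded open H-polytopes with unit normals -/
  nD : Fin cv.ng → ℕ
  HD : (f : Fin cv.ng) → Fin (nD f) → Finset (E3 × ℝ)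
  hDbd : ∀ f j, Bornology.IsBounded (polytope (HD f j))
  hDunit : ∀ f j, ∀ p ∈ HD f j, ‖p.1‖ = 1
  /-- designated territory facets -/
  desD : (f : Fin cv.ng) → Fin (nD f) → Finset (E3 × ℝ)
  hdesD : ∀ f j, desD f j ⊆ HD f j
  /-- the free zone is the territory minus the closed `√2`-collar of the cells -/
  hU : ∀ f, (cv.tent f).U = (⋃ j, polytope (HD f j)) \ {y | ∃ k, Metric.infDist y (cv.Z k) ≤ Real.sqrt 2}
  /-- solidity on the collar -/
  hcollar : ∀ f, ∀ y ∈ (⋃ j, polytope (HD f j)), y ∉ (cv.tent f).U → cv.SolidAt f y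
  /-- cells ↔ grains (declared early: the matching clauses refer to them) -/
  fk : Fin cv.nk → Fin cv.ng
  gk : Fin cv.nk → Fin cv.ng
  hfg : ∀ k, fk k ≠ gk k
  /-- gap pieces with grain labels (declared early, same reason) -/
  nQ : ℕ
  HQ : Fin nQ → Finset (E3 × ℝ)
  lab : Fin nQ → Fin cv.ng
  /-- the territory boundary: EMPTY, or on a DESIGNATED facet, or SOLID with `f`-material across (deep cell halves of `f`, gap pieces labelled `f`,
  or another territory in solid agreement) -/
  hbdry : ∀ f, ∀ y ∈ frontier (⋃ j, polytope (HD f j)),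
    cv.EmptyAt f y ∨ (∃ j, ∃ p ∈ desD f j, y ∈ facetOf (HD f j) p) ∨
      ∃ r : ℝ, 0 < r ∧ (∀ z ∈ Metric.ball y r, z ∈ closure (⋃ j, polytope (HD f j)) → cv.SolidAt f z) ∧
        Metric.ball y r ⊆ closure (⋃ j, polytope (HD f j)) ∪
          ((⋃ k ∈ (Finset.univ.filter fun k => fk k = f), cv.Zlow k) ∪
            (⋃ k ∈ (Finset.univ.filter fun k => gk k = f), cv.Zhigh k) ∪
            (⋃ l ∈ (Finset.univ.filter fun l => lab l = f), closure (polytope (HQ l))) ∪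
            (⋃ g ∈ (Finset.univ.filter fun g => g ≠ f), {z | z ∈ closure (⋃ j, polytope (HD g j)) ∧ cv.SolidAt g z ∧
              ∃ r' : ℝ, 0 < r' ∧ cv.S f ∩ Metric.ball z (r' + 4) = cv.S g ∩ Metric.ball z (r' + 4)}))
  /-- stacking consistency of the cells with the grains' tents -/
  hS₁ : ∀ k, rigid (cv.cell k).M (cv.cell k).t '' stacking (cv.cell k).L₁ (cv.cell k).s₁ (cv.cell k).σ₁ = cv.S (fk k)
  hS₂ : ∀ k, rigid (cv.cell k).M (cv.cell k).t '' stacking (cv.cell k).L₂ (cv.cell k).s₂ (cv.cell k).σ₂ = cv.S (gk k)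
  /-- disjointness of territories, and of territories from the closed cells -/
  hDD : ∀ f g, f ≠ g → Disjoint (⋃ j, polytope (HD f j)) (⋃ j, polytope (HD g j))
  hDZ : ∀ f k, Disjoint (⋃ j, polytope (HD f j)) (cv.Z k)
  /-- which territories touch a cell, and where -/
  hside₁ : ∀ k, ∀ y ∈ closure (⋃ j, polytope (HD (fk k) j)) ∩ cv.Z k, cv.height k y ≤ -R₀
  hside₂ : ∀ k, ∀ y ∈ closure (⋃ j, polytope (HD (gk k) j)) ∩ cv.Z k, (cv.cell k).h + R₀ ≤ cv.height k y
  hside₀ : ∀ k f, f ≠ fk k → f ≠ gk k → Disjoint (closure (⋃ j, polytope (HD f j))) (cv.Z k)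
  /-- agreement contacts between territories: both LOCALLY solid, stackings coincide nearby -/
  hagree : ∀ f g, f ≠ g → ∀ y ∈ closure (⋃ j, polytope (HD f j)) ∩ closure (⋃ j, polytope (HD g j)),
    ∃ r : ℝ, 0 < r ∧ (∀ z ∈ Metric.ball y r, cv.SolidAt f z ∧ cv.SolidAt g z) ∧
      cv.S f ∩ Metric.ball y (r + 4) = cv.S g ∩ Metric.ball y (r + 4)
  /-- the deep parts of a cell are WRAPPED in solid territory of the right grain -/
  hwrap₁ : ∀ k, ∀ y ∈ cv.Z k, cv.height k y ≤ -R₀ → ∃ r : ℝ, 0 < r ∧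
    Metric.ball y r ⊆ cv.Z k ∪ {z | z ∈ closure (⋃ j, polytope (HD (fk k) j)) ∧ cv.SolidAt (fk k) z}
  hwrap₂ : ∀ k, ∀ y ∈ cv.Z k, (cv.cell k).h + R₀ ≤ cv.height k y → ∃ r : ℝ, 0 < r ∧
    Metric.ball y r ⊆ cv.Z k ∪ {z | z ∈ closure (⋃ j, polytope (HD (gk k) j)) ∧ cv.SolidAt (gk k) z}
  /-- the cells' law tables are FULL (equal to the law, not merely admissible): the texture pays exactly what the cell certifies -/
  hlaw : ∀ k i j, (¬ CoAx ((cv.cell k).A₁ i) ((cv.cell k).A₂ j) → (13 / 25 : ℝ) ≤ (cv.cell k).c i j) ∧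
    (CoAx ((cv.cell k).A₁ i) ((cv.cell k).A₂ j) → (cv.cell k).A₁ i '' fccRef ≠ (cv.cell k).A₂ j '' fccRef →
      1 / 2 * Real.sqrt (1 - ⟪(cv.cell k).m i j, e₃⟫_ℝ ^ 2) ≤ (cv.cell k).c i j)
  /-- gap pieces: bounded open polytopes, disjoint from everything -/
  hQbd : ∀ l, Bornology.IsBounded (polytope (HQ l))
  hQunit : ∀ l, ∀ p ∈ HQ l, ‖p.1‖ = 1
  hQD : ∀ l f, Disjoint (polytope (HQ l)) (⋃ j, polytope (HD f j))
  hQZ : ∀ l k, Disjoint (polytope (HQ l)) (cv.Z k)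
  hQQ : ∀ l l', l ≠ l' → Disjoint (polytope (HQ l)) (polytope (HQ l'))
  /-- designated gap facets -/
  desQ : Fin nQ → Finset (E3 × ℝ)
  hdesQ : ∀ l, desQ l ⊆ HQ l
  /-- matching of the non-designated gap facets: the far side is material of the label -/
  hQmatch : ∀ l, ∀ p ∈ HQ l \ desQ l, ∀ y ∈ facetOf (HQ l) p, ∃ r : ℝ, 0 < r ∧
    Metric.ball y r ⊆ closure (polytope (HQ l)) ∪
      ((closure (⋃ j, polytope (HD (lab l) j)) ∩ {z | cv.SolidAt (lab l) z}) ∪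
        (⋃ k ∈ (Finset.univ.filter fun k => fk k = lab l), cv.Zlow k) ∪
        (⋃ k ∈ (Finset.univ.filter fun k => gk k = lab l), cv.Zhigh k) ∪
        (⋃ l' ∈ (Finset.univ.filter fun l' => lab l' = lab l), closure (polytope (HQ l'))) ∪
        (⋃ g ∈ (Finset.univ.filter fun g => g ≠ lab l), {z | z ∈ closure (⋃ j, polytope (HD g j)) ∧ cv.SolidAt g z ∧
          ∃ r' : ℝ, 0 < r' ∧ cv.S (lab l) ∩ Metric.ball z (r' + 4) = cv.S g ∩ Metric.ball z (r' + 4)}))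
  /-- the gap budget -/
  gapArea : ℝ
  hgapArea : (∑ l, ∑ p ∈ desQ l, facetArea (facetOf (HQ l) p) p.1) +
      (∑ f, ∑ j, ∑ p ∈ desD f j, facetArea (facetOf (HD f j) p) p.1) ≤ gapArea
  /-- mass: at least `(1 − δ)N` interior balls -/
  hmass : (1 - δ) * (N : ℝ) ≤
    ((Finset.univ.filter fun i : Fin cv.N' => ∃ f, cv.DeepAt f (cv.x' i) ∧
      Metric.closedBall (cv.x' i) (Real.sqrt 2) ⊆ (⋃ j, polytope (HD f j)) ∪
        (⋃ k ∈ (Finset.univ.filter fun k => fk k = f), cv.Zlow k) ∪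
        (⋃ k ∈ (Finset.univ.filter fun k => gk k = f), cv.Zhigh k)).card : ℝ)

namespace Mesh

variable {C R₀ : ℝ} {N : ℕ} {x : Fin N → E3} {cv : CellCover C R₀ N x} {δ : ℝ}

/-- the territory of grain `f` -/
def D (μ : Mesh cv δ) (f : Fin cv.ng) : Set E3 := ⋃ j, polytope (μ.HD f j)

/-- the gap piece `l` -/
def Q (μ : Mesh cv δ) (l : Fin μ.nQ) : Set E3 := polytope (μ.HQ l)

/-- the GAP COST: designated facets plus the cells' lateral surfaces, times the support bound `3`. -/
def gapCost (μ : Mesh cv δ) : ℝ := 3 * (μ.gapArea + ∑ k, 2 * Real.pi * (cv.cell k).ρ * ((cv.cell k).h + 4 * R₀ + 2))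

end Mesh

/-! ## The level-2 composition over cover + mesh -/

/-- **THE LEVEL-2 COMPOSITION over the full interface** (cover + mesh): «TB-cover(mesh)» + «TB-energy(mesh)» + the wall law ⇒ the atomic-scale saturated
shadow theorem.  (Specialisation of `CellCover.shadowTheoremSatAtomicV5_of_cover`'s argument to the mesh's gap cost.) -/
theorem shadowTheoremSatAtomicV5_of_mesh
    (hcover : BarlowResolution → BarlowAdhesionR →
      ∀ C R₀ : ℝ, 1 ≤ R₀ → ∀ K δ θ : ℝ, 0 < δ → 0 < θ → ∃ N₀ : ℕ, ∀ N : ℕ, N₀ ≤ N → ∀ x : Fin N → E3, IsUnitPacking x →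
        IsSaturated x → 6 * (N : ℝ) - (numContacts x : ℝ) ≤ K * (N : ℝ) ^ ((2 : ℝ) / 3) →
        ∃ (cv : CellCover C R₀ N x) (μ : Mesh cv δ), cv.tilingLoss + cv.rimSum + μ.gapCost ≤ θ * (N : ℝ) ^ ((2 : ℝ) / 3))
    (henergy : PolytopeCalculus → BarlowFreeCertificate →
      ∀ (C R₀ : ℝ) (N : ℕ) (x : Fin N → E3) (δ : ℝ) (cv : CellCover C R₀ N x) (μ : Mesh cv δ),
        ∃ (n : ℕ) (G : Fin n → Set E3) (A : Fin n → (E3 ≃ₗᵢ[ℝ] E3)) (c : Fin n → Fin n → ℝ) (m : Fin n → Fin n → E3),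
          IsTexture (13 / 25) (1 / 2) n G A c m ∧ (1 - δ) * (N : ℝ) ≤ Real.sqrt 2 * vol n G ∧
          energy n G A c m ≤ cv.tentBudget + cv.chargeSum + μ.gapCost) :
    BarlowResolution → BarlowAdhesionR → BilayerWallV5 → PolytopeCalculus → BarlowFreeCertificate →
      ShadowTheoremSatAtomicV5 := by
  intro hres hadh hBW hpoly hfree _hG _hC _hNRG _hSL K δ θ hδ hθ
  obtain ⟨C, R₀, hR₀, hW⟩ := hBW
  obtain ⟨N₀, hN₀⟩ := hcover hres hadh C R₀ hR₀ K δ θ hδ hθ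
  refine ⟨N₀, fun N hN x hx hsat hK => ?_⟩
  obtain ⟨cv, μ, hslack⟩ := hN₀ N hN x hx hsat hK
  obtain ⟨n, G, A, c, m, hT, hvol, hEn⟩ := henergy hpoly hfree C R₀ N x δ cv μ
  refine ⟨n, G, A, c, m, hT, hvol, ?_⟩
  have hdisc := cv.tentBudget_add_chargeSum_le hR₀ hW
  linarith

end Summit.Ventures.Crystal3D.Cruxes.TextureLiminf.TexShadow

end
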